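import Literature.AnabelianGeometry.SemiGraphs.FreeProPRankTwo
import Literature.AnabelianGeometry.SemiGraphs.SurfaceTypeLoopModels
import Literature.AnabelianGeometry.SemiGraphs.PadicIntProPCompletion
import Mathlib.NumberTheory.Padics.RingHoms
import HarnessLib

/-!
# `F̂₂⁽ᵖ⁾`: `ℤ_p`-powers, the procyclic subgroups `⟨a⟩‾`, `⟨a bᵖⁿ⟩‾` and the Nielsen automorphisms `θₙ`

Sequel to `FreeProPRankTwo.lean` (classical objects: Ribes–Zalesskii, *Profinite Groups*, §3.3 and
§4.1 "procyclic groups"; Serre, *Galois Cohomology* I §1.5), again DERIVED from the tree's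
`IsProSigmaCompletion` API, nothing re-defined:

* over abc-iut-L3-t7's `PadicInt.isProSigmaCompletion_intCast` (`ℤ → ℤ_p` is a pro-`{p}` completion,
  `PadicIntProPCompletion.lean`): (`zpow`) for every `g ∈ F̂₂⁽ᵖ⁾` the `ℤ_p`-power map `t ↦ gᵗ`, the unique continuous homomorphism `ℤ_p → F̂₂⁽ᵖ⁾` with
  `1 ↦ g`, whose image is the closed procyclic subgroup `⟨g⟩‾` (`range_zpow`);
* `α = zpow a : ℤ_p → F̂₂⁽ᵖ⁾` with `χ_a ∘ α = id` (so `α` is injective with image `A = ⟨a⟩‾`);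
* the Nielsen automorphisms `θₙ : F̂₂⁽ᵖ⁾ ≅ F̂₂⁽ᵖ⁾`, `a ↦ a bᵖⁿ`, `b ↦ b` (continuous, from the
  uniqueness of pro-`p` completions along the Nielsen automorphism of `F₂`), the free basis
  `nielsenBasis n = (x₀ x₁ᵖⁿ, x₁)` of `F₂`, `Aₙ = ⟨a bᵖⁿ⟩‾ = im(θₙ ∘ α)`, and the abelianised formulas
  `ab (θₙ g) = (u, v + pⁿ u)` for `ab g = (u, v)`, `ab (θₙ (α t)) = (t, pⁿ t)`.

Purpose: the edge gluings of the semi-graph of anabelioids `𝒢_θ` of the abc-iut L3 FRONTIER programme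
«REFUTE-F1732» (brick R1).  Honest framing: classical group theory; nothing here bears on [IUTchIII]
Cor. 3.12; typed ≠ proved elsewhere.
-/

noncomputable section

open Topology Filter Multiplicative
open Literature.AnabelianGeometry.SemiGraphs.SemiGraphOfAnabelioids (IsProSigmaCompletion)
open Literature.AnabelianGeometry.SemiGraphs.SemiGraphOfAnabelioids.IsProSigmaCompletion
open Literature.AnabelianGeometry.Anabelioids (IsSigmaInteger)

namespace Literature.AnabelianGeometry.SemiGraphs.FreeProPRankTwo

variable (p : ℕ)

/-! ### The closed procyclic subgroups `A = ⟨a⟩‾`, `Aₙ = ⟨a b^(pⁿ)⟩‾` -/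

/-- The closed procyclic subgroup `A = ⟨a⟩‾` (literally `(zpowers (ι x₀)).topologicalClosure`, the
shape of the tree's `closure_zpowers_inf_conj_eq_bot`). [cite: RibesZalesskii2010, §3.3] -/
def A : Subgroup (Grp p) := (Subgroup.zpowers (a p)).topologicalClosure

/-- `A` in the malnormality engine's shape. [cite: RibesZalesskii2010, §3.3] -/
theorem A_eq : A p = (Subgroup.zpowers (ι p (FreeGroupBasis.ofFreeGroup (Fin 2) 0))).topologicalClosure :=
  rfl

/-- The closed procyclic subgroup `Aₙ = ⟨a b^(pⁿ)⟩‾`. [cite: RibesZalesskii2010, §3.3] -/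
def An (n : ℕ) : Subgroup (Grp p) := (Subgroup.zpowers (a p * b p ^ p ^ n)).topologicalClosure

/-! ### The Nielsen automorphisms `θₙ` -/

/-- `x₀ ↦ x₀ x₁^(pⁿ)`, `x₁ ↦ x₁` on `F₂`. [cite: RibesZalesskii2010, §3.3] -/
def nielsenFwd (n : ℕ) : FreeGroup (Fin 2) →* FreeGroup (Fin 2) :=
  FreeGroup.lift ![FreeGroup.of 0 * FreeGroup.of 1 ^ p ^ n, FreeGroup.of 1]

/-- `x₀ ↦ x₀ x₁^(-pⁿ)`, `x₁ ↦ x₁` on `F₂` (the inverse). [cite: RibesZalesskii2010, §3.3] -/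
def nielsenBwd (n : ℕ) : FreeGroup (Fin 2) →* FreeGroup (Fin 2) :=
  FreeGroup.lift ![FreeGroup.of 0 * (FreeGroup.of 1 ^ p ^ n)⁻¹, FreeGroup.of 1]

/-- **The Nielsen automorphism** `x₀ ↦ x₀ x₁^(pⁿ)`, `x₁ ↦ x₁` of `F₂`. [cite: RibesZalesskii2010, §3.3] -/
def nielsen (n : ℕ) : FreeGroup (Fin 2) ≃* FreeGroup (Fin 2) :=
  MonoidHom.toMulEquiv (nielsenFwd p n) (nielsenBwd p n)
    (FreeGroup.ext_hom _ _ fun i => by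
      fin_cases i <;> simp [nielsenFwd, nielsenBwd, FreeGroup.lift_apply_of, mul_assoc])
    (FreeGroup.ext_hom _ _ fun i => by
      fin_cases i <;> simp [nielsenFwd, nielsenBwd, FreeGroup.lift_apply_of, mul_assoc])

/-- `nielsen n x₀ = x₀ x₁^(pⁿ)`. [cite: RibesZalesskii2010, §3.3] -/
@[simp] theorem nielsen_of_zero (n : ℕ) :
    nielsen p n (FreeGroup.of 0) = FreeGroup.of 0 * FreeGroup.of 1 ^ p ^ n := by
  simp [nielsen, nielsenFwd, FreeGroup.lift_apply_of]

/-- `nielsen n x₁ = x₁`. [cite: RibesZalesskii2010, §3.3] -/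
@[simp] theorem nielsen_of_one (n : ℕ) : nielsen p n (FreeGroup.of 1) = FreeGroup.of 1 := by
  simp [nielsen, nielsenFwd, FreeGroup.lift_apply_of]

/-- The free basis `(x₀ x₁^(pⁿ), x₁)` of `F₂`. [cite: RibesZalesskii2010, §3.3] -/
def nielsenBasis (n : ℕ) : FreeGroupBasis (Fin 2) (FreeGroup (Fin 2)) :=
  (FreeGroupBasis.ofFreeGroup (Fin 2)).map (nielsen p n)

/-- `nielsenBasis n 0 = x₀ x₁^(pⁿ)`. [cite: RibesZalesskii2010, §3.3] -/
@[simp] theorem nielsenBasis_zero (n : ℕ) :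
    nielsenBasis p n 0 = FreeGroup.of 0 * FreeGroup.of 1 ^ p ^ n := by
  rw [nielsenBasis, FreeGroupBasis.map_apply]
  exact nielsen_of_zero p n

/-- `nielsenBasis n 1 = x₁`. [cite: RibesZalesskii2010, §3.3] -/
@[simp] theorem nielsenBasis_one (n : ℕ) : nielsenBasis p n 1 = FreeGroup.of 1 := by
  rw [nielsenBasis, FreeGroupBasis.map_apply]
  exact nielsen_of_one p n

/-- `ι (x₀ x₁^(pⁿ)) = a b^(pⁿ)`. [cite: RibesZalesskii2010, §3.3] -/
theorem ι_nielsenBasis_zero (n : ℕ) : ι p (nielsenBasis p n 0) = a p * b p ^ p ^ n := by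
  rw [nielsenBasis_zero, map_mul, map_pow]
  rfl

/-- `ι (nielsenBasis n 1) = b`. [cite: RibesZalesskii2010, §3.3] -/
theorem ι_nielsenBasis_one (n : ℕ) : ι p (nielsenBasis p n 1) = b p := by
  rw [nielsenBasis_one]
  rfl

/-- `ι ∘ nielsen n` is again a pro-`{p}` completion of `F₂`. [cite: MochizukiSemiAnbd2006, Ex. 2.10 p.31] -/
theorem isProSigmaCompletion_ι_comp_nielsen (n : ℕ) :
    IsProSigmaCompletion ({p} : Set ℕ) ((ι p).comp (nielsen p n).toMonoidHom) :=
  (isProSigmaCompletion_ι p).comp_mulEquiv (nielsen p n)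

/-- Existence of the continuous automorphism extending `nielsen n` (uniqueness of the pro-`p`
completion). [cite: RibesZalesskii2010, §3.3] -/
theorem exists_θ (n : ℕ) : ∃ e : Grp p ≃ₜ* Grp p, ∀ γ, e (ι p γ) = ι p (nielsen p n γ) :=
  exists_continuousMulEquiv (isProSigmaCompletion_ι p) (isProSigmaCompletion_ι_comp_nielsen p n)

/-- **The Nielsen automorphism `θₙ` of `F̂₂⁽ᵖ⁾`**: `a ↦ a b^(pⁿ)`, `b ↦ b` (a `ContinuousMulEquiv`).
[cite: RibesZalesskii2010, §3.3] -/
def θ (n : ℕ) : Grp p ≃ₜ* Grp p := (exists_θ p n).choose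

/-- `θₙ ∘ ι = ι ∘ nielsen n`. [cite: RibesZalesskii2010, §3.3] -/
theorem θ_ι (n : ℕ) (γ : FreeGroup (Fin 2)) : θ p n (ι p γ) = ι p (nielsen p n γ) :=
  (exists_θ p n).choose_spec γ

/-- `θₙ a = a b^(pⁿ)`. [cite: RibesZalesskii2010, §3.3] -/
@[simp] theorem θ_a (n : ℕ) : θ p n (a p) = a p * b p ^ p ^ n := by
  rw [a, θ_ι, nielsen_of_zero, map_mul, map_pow]
  rfl

/-- `θₙ b = b`. [cite: RibesZalesskii2010, §3.3] -/
@[simp] theorem θ_b (n : ℕ) : θ p n (b p) = b p := by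
  rw [b, θ_ι, nielsen_of_one]

/-- `θₙ` as a continuous monoid homomorphism. [cite: RibesZalesskii2010, §3.3] -/
def θHom (n : ℕ) : Grp p →ₜ* Grp p where
  toMonoidHom := (θ p n).toMonoidHom
  continuous_toFun := (θ p n).continuous

/-- `θHom n g = θ n g`. [cite: RibesZalesskii2010, §3.3] -/
@[simp] theorem θHom_apply (n : ℕ) (g : Grp p) : θHom p n g = θ p n g := rfl

/-- `Aₙ` in the malnormality engine's shape for the free basis `nielsenBasis n` (no `θ`-transport
needed). [cite: RibesZalesskii2010, §3.3] -/
theorem An_eq (n : ℕ) :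
    An p n = (Subgroup.zpowers (ι p (nielsenBasis p n 0))).topologicalClosure := by
  rw [ι_nielsenBasis_zero]
  rfl

section Padic

variable [hp : Fact p.Prime]

/-! ### Continuous homomorphisms out of `ℤ_p` (over abc-iut-L3-t7's `PadicInt.isProSigmaCompletion_intCast`) -/

/-- `ofAdd m = (ofAdd 1) ^ m` in `Multiplicative ℤ_[p]`. [cite: RibesZalesskii2010, §4.1] -/
theorem ofAdd_intCast_eq_pow (m : ℤ) : ofAdd (m : ℤ_[p]) = ofAdd (1 : ℤ_[p]) ^ m := by
  rw [← ofAdd_zsmul, zsmul_one]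

/-- `ℤ` is dense in `ℤ_p`, multiplicative phrasing: the range of `ℤ → ℤ_p` is dense (from the tree's
`PadicInt.isProSigmaCompletion_intCast`). [cite: RibesZalesskii2010, §4.1] -/
theorem denseRange_intCast_multiplicative :
    DenseRange (AddMonoidHom.toMultiplicative (Int.castAddHom ℤ_[p]) :
      Multiplicative ℤ →* Multiplicative ℤ_[p]) :=
  (PadicInt.isProSigmaCompletion_intCast (p := p)).dense

/-- `ℤ_p` is topologically generated by `1`: `(zpowers (ofAdd 1)).topologicalClosure = ⊤`.
[cite: RibesZalesskii2010, §4.1] -/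
theorem topologicalClosure_zpowers_ofAdd_one :
    (Subgroup.zpowers (ofAdd (1 : ℤ_[p]))).topologicalClosure = ⊤ := by
  rw [eq_top_iff]
  intro t _
  rw [← SetLike.mem_coe, Subgroup.topologicalClosure_coe]
  have ht : t ∈ closure (Set.range (AddMonoidHom.toMultiplicative (Int.castAddHom ℤ_[p]) :
      Multiplicative ℤ →* Multiplicative ℤ_[p])) := by
    rw [(denseRange_intCast_multiplicative p).closure_range]
    trivial
  refine closure_mono ?_ ht
  rintro _ ⟨m, rfl⟩
  refine ⟨m.toAdd, ?_⟩
  change ofAdd (1 : ℤ_[p]) ^ m.toAdd = ofAdd ((m.toAdd : ℤ) : ℤ_[p])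
  rw [ofAdd_intCast_eq_pow]

/-- Continuous homomorphisms out of `ℤ_p` into a Hausdorff group are determined by the image of `1`.
[cite: RibesZalesskii2010, §4.1] -/
theorem padicInt_continuousMonoidHom_ext {M : Type*} [Group M] [TopologicalSpace M] [T2Space M]
    {F F' : Multiplicative ℤ_[p] →ₜ* M} (h : F (ofAdd 1) = F' (ofAdd 1)) : F = F' := by
  have key : (F : Multiplicative ℤ_[p] → M) = F' :=
    Continuous.ext_on (denseRange_intCast_multiplicative p) F.continuous F'.continuous (by
      rintro _ ⟨m, rfl⟩
      change F (ofAdd ((m.toAdd : ℤ) : ℤ_[p])) = F' (ofAdd ((m.toAdd : ℤ) : ℤ_[p]))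
      rw [ofAdd_intCast_eq_pow, map_zpow, map_zpow, h])
  exact ContinuousMonoidHom.ext fun x => congrFun key x

/-! ### `ℤ_p`-powers in `F̂₂⁽ᵖ⁾` -/

/-- Existence of the continuous extension of `m ↦ gᵐ` from `ℤ` to `ℤ_p` (universal property of the
pro-`p` completion `ℤ → ℤ_p`, abc-iut-L3-t7's `PadicInt.isProSigmaCompletion_intCast`, towards the
pro-`p` group `F̂₂⁽ᵖ⁾`). [cite: RibesZalesskii2010, §4.1] -/
theorem exists_zpow (g : Grp p) : ∃ F : Multiplicative ℤ_[p] →* Grp p,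
    Continuous F ∧ ∀ m : ℤ, F (ofAdd (m : ℤ_[p])) = g ^ m := by
  obtain ⟨F, hF, hFι⟩ := exists_continuous_extend_profinite
    (PadicInt.isProSigmaCompletion_intCast (p := p))
    (fun V hV hVo => @isSigmaInteger_index p V hV hVo) (zpowersHom (Grp p) g)
  refine ⟨F, hF, fun m => ?_⟩
  have h := hFι (ofAdd m)
  rw [zpowersHom_apply, toAdd_ofAdd] at h
  exact h

/-- **The `ℤ_p`-power map** `zpow g : ℤ_p → F̂₂⁽ᵖ⁾`, `t ↦ gᵗ`: the unique continuous homomorphism with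
`1 ↦ g`. [cite: RibesZalesskii2010, §4.1] -/
def zpow (g : Grp p) : Multiplicative ℤ_[p] →ₜ* Grp p where
  toMonoidHom := (exists_zpow p g).choose
  continuous_toFun := (exists_zpow p g).choose_spec.1

/-- `zpow g m = gᵐ` for `m ∈ ℤ`. [cite: RibesZalesskii2010, §4.1] -/
@[simp] theorem zpow_ofAdd_intCast (g : Grp p) (m : ℤ) : zpow p g (ofAdd (m : ℤ_[p])) = g ^ m :=
  (exists_zpow p g).choose_spec.2 m

/-- `zpow g 1 = g`. [cite: RibesZalesskii2010, §4.1] -/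
@[simp] theorem zpow_ofAdd_one (g : Grp p) : zpow p g (ofAdd 1) = g := by
  have h := zpow_ofAdd_intCast p g 1
  rwa [Int.cast_one, zpow_one] at h

/-- `zpow g m = gᵐ` for `m ∈ ℕ`. [cite: RibesZalesskii2010, §4.1] -/
@[simp] theorem zpow_ofAdd_natCast (g : Grp p) (m : ℕ) : zpow p g (ofAdd (m : ℤ_[p])) = g ^ m := by
  have h := zpow_ofAdd_intCast p g m
  rwa [Int.cast_natCast, zpow_natCast] at h

/-- Uniqueness of `zpow g`. [cite: RibesZalesskii2010, §4.1] -/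
theorem zpow_unique (g : Grp p) (F : Multiplicative ℤ_[p] →ₜ* Grp p) (hF : F (ofAdd 1) = g) :
    F = zpow p g :=
  padicInt_continuousMonoidHom_ext p (hF.trans (zpow_ofAdd_one p g).symm)

/-- **The image of `zpow g` is the closed procyclic subgroup `⟨g⟩‾`.** [cite: RibesZalesskii2010, §4.1] -/
theorem range_zpow (g : Grp p) :
    (zpow p g).toMonoidHom.range = (Subgroup.zpowers g).topologicalClosure := by
  apply le_antisymm
  · -- `range ≤ closure`: `ℤ_p = closure ⟨1⟩` and `zpow g` is continuous with `zpow g ⟨1⟩ = ⟨g⟩`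
    rintro _ ⟨t, rfl⟩
    have ht : t ∈ closure ((Subgroup.zpowers (ofAdd (1 : ℤ_[p]))) : Set (Multiplicative ℤ_[p])) := by
      rw [← Subgroup.topologicalClosure_coe, topologicalClosure_zpowers_ofAdd_one]
      trivial
    have himg := image_closure_subset_closure_image (zpow p g).continuous ⟨t, ht, rfl⟩
    rw [← SetLike.mem_coe, Subgroup.topologicalClosure_coe]
    refine closure_mono ?_ himg
    rintro _ ⟨_, ⟨m, rfl⟩, rfl⟩
    refine ⟨m, ?_⟩
    change g ^ m = zpow p g (ofAdd (1 : ℤ_[p]) ^ m)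
    rw [map_zpow, zpow_ofAdd_one]
  · refine Subgroup.topologicalClosure_minimal _ ?_ ?_
    · rintro _ ⟨m, rfl⟩
      exact ⟨ofAdd (m : ℤ_[p]), by simp⟩
    · exact (isCompact_range (zpow p g).continuous).isClosed

/-! ### The upper gluing `α = zpow a : ℤ_p ↪ F̂₂⁽ᵖ⁾` and `A = ⟨a⟩‾` -/

/-- **The gluing homomorphism `α : ℤ_p → F̂₂⁽ᵖ⁾`, `t ↦ aᵗ`.** [cite: RibesZalesskii2010, §4.1] -/
def α : Multiplicative ℤ_[p] →ₜ* Grp p := zpow p (a p)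

/-- `α = zpow a`. [cite: RibesZalesskii2010, §4.1] -/
theorem α_def : α p = zpow p (a p) := rfl

/-- `α 1 = a`. [cite: RibesZalesskii2010, §4.1] -/
@[simp] theorem α_ofAdd_one : α p (ofAdd 1) = a p := zpow_ofAdd_one p (a p)

/-- `χ_a ∘ α = id`: `χ_a` is a continuous retraction of `α`. [cite: RibesZalesskii2010, §4.1] -/
@[simp] theorem χa_α (t : Multiplicative ℤ_[p]) : χa p (α p t) = t := by
  have h : (χa p).comp (α p) = ContinuousMonoidHom.id _ :=
    padicInt_continuousMonoidHom_ext p (by simp [α_def])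
  exact DFunLike.congr_fun h t

/-- `χ_b ∘ α = 0`. [cite: RibesZalesskii2010, §4.1] -/
@[simp] theorem χb_α (t : Multiplicative ℤ_[p]) : χb p (α p t) = 1 := by
  let triv : Multiplicative ℤ_[p] →ₜ* Multiplicative ℤ_[p] :=
    { toMonoidHom := 1, continuous_toFun := continuous_const }
  have h : (χb p).comp (α p) = triv :=
    padicInt_continuousMonoidHom_ext p (by
      change χb p (α p (ofAdd 1)) = 1
      simp [α_def])
  exact DFunLike.congr_fun h t

/-- `ab (α t) = (t, 0)`. [cite: RibesZalesskii2010, §4.1] -/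
theorem ab_α (t : Multiplicative ℤ_[p]) : ab p (α p t) = ofAdd (t.toAdd, 0) := by
  rw [ab_eq, χa_α, χb_α]
  rfl

/-- `α` is injective. [cite: RibesZalesskii2010, §4.1] -/
theorem α_injective : Function.Injective (α p) := fun s t h => by
  simpa using congrArg (χa p) h

/-- The image of `α` is `A = ⟨a⟩‾`. [cite: RibesZalesskii2010, §4.1] -/
theorem range_α : (α p).toMonoidHom.range = A p := range_zpow p (a p)

/-- `α t ∈ A`. [cite: RibesZalesskii2010, §4.1] -/
theorem α_mem_A (t : Multiplicative ℤ_[p]) : α p t ∈ A p := by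
  rw [← range_α]
  exact ⟨t, rfl⟩

/-- `A` is infinite. [cite: RibesZalesskii2010, §4.1] -/
theorem infinite_A : (A p : Set (Grp p)).Infinite := by
  rw [← range_α]
  exact Set.infinite_range_of_injective (α_injective p)

/-! ### `θₙ` on the abelianisation -/

/-- **`θₙ` on the abelianisation is the shear `(u, v) ↦ (u, v + pⁿ u)`.** [cite: RibesZalesskii2010, §3.3] -/
theorem ab_θ (n : ℕ) (g : Grp p) :
    ab p (θ p n g) = ofAdd ((ab p g).toAdd.1, (ab p g).toAdd.2 + (p : ℤ_[p]) ^ n * (ab p g).toAdd.1) := by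
  -- both sides are continuous homomorphisms `F̂₂⁽ᵖ⁾ → ℤ_p × ℤ_p` agreeing on `a`, `b`
  let S : Grp p →ₜ* Multiplicative (ℤ_[p] × ℤ_[p]) :=
    { toFun := fun g => ofAdd ((ab p g).toAdd.1, (ab p g).toAdd.2 + (p : ℤ_[p]) ^ n * (ab p g).toAdd.1)
      map_one' := by simp
      map_mul' := fun x y => by
        simp only [map_mul, toAdd_mul, Prod.fst_add, Prod.snd_add, ← ofAdd_add, Prod.mk_add_mk]
        congr 2
        ring
      continuous_toFun := by
        apply continuous_ofAdd.comp
        have hc : Continuous fun g : Grp p => (ab p g).toAdd := continuous_toAdd.comp (ab p).continuous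
        exact (continuous_fst.comp hc).prodMk
          ((continuous_snd.comp hc).add (continuous_const.mul (continuous_fst.comp hc))) }
  have h : (ab p).comp (θHom p n) = S := by
    refine continuousMonoidHom_ext p ?_ ?_
    · show ab p (θ p n (a p)) =
        ofAdd ((ab p (a p)).toAdd.1, (ab p (a p)).toAdd.2 + (p : ℤ_[p]) ^ n * (ab p (a p)).toAdd.1)
      rw [θ_a, map_mul, map_pow, ab_a, ab_b, toAdd_ofAdd, ← ofAdd_nsmul, ← ofAdd_add]
      congr 1
      ext <;> simp
    · show ab p (θ p n (b p)) =
        ofAdd ((ab p (b p)).toAdd.1, (ab p (b p)).toAdd.2 + (p : ℤ_[p]) ^ n * (ab p (b p)).toAdd.1)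
      rw [θ_b, ab_b, toAdd_ofAdd]
      congr 1
      ext <;> simp
  exact DFunLike.congr_fun h g

/-- `χ_a ∘ θₙ = χ_a`. [cite: RibesZalesskii2010, §3.3] -/
@[simp] theorem χa_θ (n : ℕ) (g : Grp p) : χa p (θ p n g) = χa p g := by
  rw [χa_apply, ab_θ, toAdd_ofAdd, χa_apply]

/-- `χ_b (θₙ g) = χ_b g + pⁿ χ_a g`. [cite: RibesZalesskii2010, §3.3] -/
theorem χb_θ (n : ℕ) (g : Grp p) :
    χb p (θ p n g) = ofAdd ((χb p g).toAdd + (p : ℤ_[p]) ^ n * (χa p g).toAdd) := by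
  rw [χb_apply, ab_θ, toAdd_ofAdd, χb_apply, χa_apply, toAdd_ofAdd, toAdd_ofAdd]

/-! ### The lower gluing `θₙ ∘ α` and `Aₙ = ⟨a b^(pⁿ)⟩‾` -/

/-- **The lower gluing homomorphism `θₙ ∘ α : ℤ_p → F̂₂⁽ᵖ⁾`, `t ↦ (a b^(pⁿ))ᵗ`.**
[cite: RibesZalesskii2010, §4.1] -/
def θα (n : ℕ) : Multiplicative ℤ_[p] →ₜ* Grp p := (θHom p n).comp (α p)

/-- `θα n t = θₙ (α t)`. [cite: RibesZalesskii2010, §4.1] -/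
@[simp] theorem θα_apply (n : ℕ) (t : Multiplicative ℤ_[p]) : θα p n t = θ p n (α p t) := rfl

/-- `θₙ ∘ α = zpow (a b^(pⁿ))`. [cite: RibesZalesskii2010, §4.1] -/
theorem θα_eq_zpow (n : ℕ) : θα p n = zpow p (a p * b p ^ p ^ n) :=
  zpow_unique p _ _ (by simp)

/-- The image of `θₙ ∘ α` is `Aₙ`. [cite: RibesZalesskii2010, §4.1] -/
theorem range_θα (n : ℕ) : (θα p n).toMonoidHom.range = An p n := by
  rw [θα_eq_zpow]
  exact range_zpow p _

/-- `θₙ (α t) ∈ Aₙ`. [cite: RibesZalesskii2010, §4.1] -/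
theorem θ_α_mem_An (n : ℕ) (t : Multiplicative ℤ_[p]) : θ p n (α p t) ∈ An p n := by
  rw [← range_θα]
  exact ⟨t, rfl⟩

/-- `Aₙ = θₙ(A)`. [cite: RibesZalesskii2010, §4.1] -/
theorem An_eq_map_A (n : ℕ) : An p n = (A p).map (θ p n).toMonoidHom := by
  rw [← range_θα, ← range_α, MonoidHom.range_eq_map, MonoidHom.range_eq_map, Subgroup.map_map]
  rfl

/-- **`ab (θₙ (α t)) = (t, pⁿ t)`** — the abelianised lower gluing. [cite: RibesZalesskii2010, §4.1] -/
theorem ab_θ_α (n : ℕ) (t : Multiplicative ℤ_[p]) :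
    ab p (θ p n (α p t)) = ofAdd (t.toAdd, (p : ℤ_[p]) ^ n * t.toAdd) := by
  rw [ab_θ, ab_α, toAdd_ofAdd, zero_add]

/-- `χ_a (θₙ (α t)) = t`. [cite: RibesZalesskii2010, §4.1] -/
@[simp] theorem χa_θ_α (n : ℕ) (t : Multiplicative ℤ_[p]) : χa p (θ p n (α p t)) = t := by
  rw [χa_θ, χa_α]

/-- `θₙ ∘ α` is injective. [cite: RibesZalesskii2010, §4.1] -/
theorem θα_injective (n : ℕ) : Function.Injective (θα p n) := fun s t h => by
  simpa using congrArg (χa p) h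

/-- `Aₙ` is infinite. [cite: RibesZalesskii2010, §4.1] -/
theorem infinite_An (n : ℕ) : (An p n : Set (Grp p)).Infinite := by
  rw [← range_θα]
  exact Set.infinite_range_of_injective (θα_injective p n)

end Padic

end Literature.AnabelianGeometry.SemiGraphs.FreeProPRankTwo

end
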